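import Summits.Schanuel.Schanuel.Theorems.DiophantineDichotomyKhovanskiiApproxTypeEvLambertLiouville
import Summits.Schanuel.Schanuel.Theorems.DiophantineDichotomyKhovanskiiApproxTypeEvLambertLiouvilleAnchored

/-!
# Line `lambert-liouville-kill` — crux `DiophantineDichotomy.KhovanskiiApproxTypeEv` (stmt-Schanuel-14972)
# CERTIFICATE SKELETON v4 (lead `prover-line-stmt-Schanuel-14972-a1-0`, 2026-08-16): ALL STUBS AND BOTH
# CERTIFICATES LANDED — this file is now import-only plus the conditional-kill corollaries

**This file has NO `KhovanskiiApproxTypeEv_of` (crux-plan verdict `no-skeleton`; `ledger skeleton check` reports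
`skeleton.missing` BY DESIGN).**  The idea `Ideas/lambert-liouville-kill.md` runs AGAINST the crux; no honest
`_of` exists for the crux AS FILED (`khovanskiiApproxTypeEv_iff_stubs` p125111 + `barriers_of_khovanskiiApproxTypeEv`
p125943).  What the line delivers is the idea's unconditional content as two HARDNESS CERTIFICATES, now LANDED
sorry-free under `Theorems/` (`--supports stmt-Schanuel-14972`, axioms `propext`/`Classical.choice`/`Quot.sound`):

  `notLiouville_lambert_of_ev         : KhovanskiiApproxTypeEv         → ∀ k x, 1 ≤ k → 0 < x → k·x·eˣ = 1 → ¬ Liouville x`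
      — `Theorems/DiophantineDichotomyKhovanskiiApproxTypeEvLambertLiouville.lean` (p128146)
  `notLiouville_lambert_of_evAnchored : KhovanskiiApproxTypeEvAnchored → ∀ k x, 1 ≤ k → 0 < x → k·x·eˣ = 1 → ¬ Liouville x`
      — `Theorems/DiophantineDichotomyKhovanskiiApproxTypeEvLambertLiouvilleAnchored.lean` (p128515)
  (+ `notLiouville_lambert_of_ev'`, the crux as filed through the anchored family, same file)

from the eleven registered stubs, each landed in its own file
`Theorems/DiophantineDichotomyKhovanskiiApproxTypeEvLambert<Stub>.lean`:
`stub_liouvilleWindow` p127801 · `stub_expOneDegreeMeasure` p127822 (from the PROVED Nesterenko–Waldschmidt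
approximation measure `NW1996.approx_measure_exp_one`) · `stub_syncDiaz` p127960 (Diaz, `Bugeaud2004_thm_8_11_holds`,
PROVED) · `stub_challengerLevel` p127871 · `stub_challengerDist` p127839 · `stub_endgame` p127875 ·
`stub_anchoredPoint` p127915 · `stub_syncApproximant` p127962 (AP(2) at `(iπ, e)`,
`approximationProperty_trdeg_le_two`, PROVED) · `stub_anchoredLevel` p128109 · `stub_anchoredDist` p128140 ·
`stub_anchoredEndgame` p128182.

i.e. the crux — and already its ANCHORED restatement (R1 of `Lines/Sketch-dead.md`, what the route consumes,
p124086) — asserts that no Lambert number `W(1/k)` is a Liouville number: a Diophantine statement NOT implied by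
Schanuel's conjecture and absent from print.  Hence the idea's conditional kill `LiouvilleLambert → ¬ KhovanskiiApproxTypeEv`
with NO further hypothesis (below; `LiouvilleLambert` is believed FALSE — recorded hardness, not a refutation,
never to be filed `--negative-modulo`, triage r1-2).

History: v3b (crux-plan seat, 11 `stub_*` sorries, compositions sorry-free) → v4 (this lead: 11/11 stubs landed in
two waves + lead's `stub_syncDiaz`; compositions landed; 0 sorries).
-/

noncomputable section

set_option linter.dupNamespace false

namespace Summit.Schanuel.Schanuel.Cruxes.KhovanskiiApproxTypeEv.LambertLiouvilleKill

open Summit.Schanuel.Schanuel.Theses.DiophantineDichotomy (KhovanskiiApproxTypeEv)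
open Summit.Schanuel.Schanuel.Cruxes.KhovanskiiApproxTypeEv.AnchoredReduction (KhovanskiiApproxTypeEvAnchored)

/-! ## Vocabulary -/

/-- **The (believed false, unrefuted in print) hypothesis of the conditional kill:** some Lambert number
`x = W(1/k)` (`k ≥ 1`, `0 < x`, `k x eˣ = 1`) is a Liouville number. -/
def LiouvilleLambert : Prop :=
  ∃ (k : ℕ) (x : ℝ), 1 ≤ k ∧ 0 < x ∧ (k : ℝ) * x * Real.exp x = 1 ∧ Liouville x

/-! ## The conditional kill (corollaries of the landed certificates) -/

/-- **The idea's conditional kill, with NO named-fact hypothesis:** `LiouvilleLambert → ¬ KhovanskiiApproxTypeEv`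
(from the LANDED certificate `notLiouville_lambert_of_ev`, p128146).  `LiouvilleLambert` is believed FALSE and is
not constructible: recorded hardness (the crux ⊇ "no `W(1/k)` is Liouville"), not a refutation. -/
theorem ev_false_of_liouvilleLambert (hLL : LiouvilleLambert) : ¬ KhovanskiiApproxTypeEv := by
  intro hEv
  obtain ⟨k, x, hk, hx0, hx, hL⟩ := hLL
  exact notLiouville_lambert_of_ev hEv k x hk hx0 hx hL

/-- The same against the ANCHORED crux (from the LANDED certificate `notLiouville_lambert_of_evAnchored`). -/
theorem evAnchored_false_of_liouvilleLambert (hLL : LiouvilleLambert) :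
    ¬ KhovanskiiApproxTypeEvAnchored := by
  intro hEvA
  obtain ⟨k, x, hk, hx0, hx, hL⟩ := hLL
  exact notLiouville_lambert_of_evAnchored hEvA k x hk hx0 hx hL

/-- Sanity re-export: the second proof of the rank-2 certificate through the anchored family agrees in type
with the first. -/
example : (KhovanskiiApproxTypeEv → ∀ (k : ℕ) (x : ℝ), 1 ≤ k → 0 < x → (k : ℝ) * x * Real.exp x = 1 →
    ¬ Liouville x) :=
  fun hEv k x hk hx0 hx => notLiouville_lambert_of_ev' hEv k x hk hx0 hx

end Summit.Schanuel.Schanuel.Cruxes.KhovanskiiApproxTypeEv.LambertLiouvilleKill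

end
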